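import Summits.QuantumFields.BalabanUV.T4Continuum.Support.NE9EvaluationChannel
import Summits.QuantumFields.BalabanUV.T4Continuum.Support.NE9Lemma1Counting

/-!
# NE9Lemma1CountingEval — JUNCTION of the Lemma-1 counting (parts 1–2) with P2's evaluation–integral leaf
# `NE9EvaluationChannel` (its kernel-mass hypothesis DERIVED from per-piece masses + the level counts of [II] p. 8), and a
# one-piece toy inhabiting every hypothesis of `NE9Lemma1Counting.channelSizeAtStepNN_piece`
# (cell `pub-balaban`, T4-DAG §2 node U3 / §6 NE9; lineage t4-ne9-p1 = row NE9 OWNER, generation 23; part 3 of 3)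

HONEST FRAMING (T4-DAG PAGE 1).  Rung (B)+1 of the FINITE-VOLUME T⁴ programme — NOT infinite volume, NOT a mass gap, NOT the
Clay problem.  NE9 (`T4OutputRate.NE9` ∧ `FadingMemory`) is a cell NEW ESTIMATE, NOT PRINTED, NOT discharged here; spine 0/9.
HONEST DEPENDENCY (cell line, verbatim): continuum YM on T⁴ ⇐ BetaPertH ∧ nine spine estimates (0/9 proved); BetaPertH ⇐ (D1)
∧ (D4) ∧ CAP+tail; G-an2-4 gates asym, D1 and NE2/3/4.  `FlowStep.BetaPertH`, (B), (B^μ) do not occur.  [II] =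
[Balaban1988RG2Cluster] is quoted for TYPES only (ABSOLUTE RULE: nothing printed in the audited series is asserted).

WHAT.  P2's leaf `NE9EvaluationChannel.channelSizeAtStepNN_of_kernelMass` (t4-ne9-p2 gen 19, task F2) proves the NE9 frame's
per-creation-step size binder `ChannelSizeAtStepNN` for every EVALUATION–INTEGRAL channel from ONE displayed kernel-mass
inequality `Σ_{X ∈ F k s y, scale X = j} e^{−κd(X)}·∫|w k s y X| ∂ν ≤ wt k y·τ k j`, whose TYPE it cites as (1.24) weight mass ×
term size + the E₀-free sums (1.25)–(1.28) + p. 8 l. 9–10.  §1 `kernelMass_of_levels` DERIVES that inequality — with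
`wt = NE9Lemma1Counting.weightOf`, `τ = NE9Lemma1Counting.tauOf L ℓ = (6L)⁴·ℓ k j` — from (i) a DOMINATION of the weighted
per-source-domain masses by a nested sum of per-piece masses over index data `P : PieceData` (displayed structural identity;
e.g. the weight of a source domain is the sum of the (1.23) contour weights of its pieces on a common parameter space and
`∫|Σw| ≤ Σ∫|w|`), (ii) per-piece masses of the (1.24)×(1.25) shape WITHOUT the size factor (the term's size is supplied by P2's
theorem; for the literal (1.23) contour weights the mass is `(1/r)·(e^{κ₁}(e^{κ₁}−1)⁻²)^{N}`, `B13Sect1Arith.norm_cauchyOp_le'` /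
`bound_124`, times the (I.3.54)-type gain carried by the Taylor-remainder contour), (iii) the level counts; and
`channelSizeAtStepNN_eval_of_levels` composes it with P2's theorem BY NAME.  §2 NON-VACUITY: a one-piece toy (`toyP`) on toy
carriers inhabits `SrcScale`, `PieceBound`, `LevelCounts` at once and hence the S5 binder with the counted weight and the
profile `(6L)⁴·(L⁻¹)^{k−j}` (`toy_channelSizeAtStepNN`, `toy_tau_eq`).  DISGUISE TEST: one input family, one history throughout.

References (TYPES only): T. Bałaban, *Renormalization group approach to lattice gauge field theories. II. Cluster expansions*,
Commun. Math. Phys. **116**, 1–22 (1988) [Balaban1988RG2Cluster], (1.23)–(1.29) pp. 7–8, (1.36) p. 9.  Summits-side NEW work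
(LEAN PLACEMENT RULE); imports `NE9EvaluationChannel` (P2) and part 2; modifies nothing; 0 sorry.  Value = kernel bookkeeping
(the arithmetic link between P2's F2 leaf and the Lemma-1 certificate), NOT summit progress.
-/

noncomputable section

namespace Summit.QuantumFields.BalabanUV.T4Continuum.NE9Lemma1CountingEval

open scoped BigOperators
open MeasureTheory
open Literature.MathematicalPhysics.QuantumFieldTheory.Balaban1983to89
open Literature.MathematicalPhysics.QuantumFieldTheory.Balaban1983to89.T4OutputRate
open Literature.MathematicalPhysics.QuantumFieldTheory.Balaban1983to89.T4HistoryLipschitzRecursion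
open Summit.QuantumFields.BalabanUV.T4Continuum.NE9EvaluationChannel (evalChannel EvalAdm channelSizeAtStepNN_of_kernelMass)
open Summit.QuantumFields.BalabanUV.T4Continuum.NE9Lemma1Counting

variable {C : Carriers} {Bg ι α β γ : Type}

/-! ## §1 JUNCTION with P2's leaf `NE9EvaluationChannel`: the kernel-mass inequality from per-piece masses + the counts -/

section Eval

variable {Ω : Type*} [MeasurableSpace Ω]
  {F : ℕ → (ℕ → ℝ) → ι → Finset C.Dom} {ν : ℕ → (ℕ → ℝ) → ι → C.Dom → Measure Ω}
  {w : ℕ → (ℕ → ℝ) → ι → C.Dom → Ω → ℝ} {bg : ℕ → (ℕ → ℝ) → ι → C.Dom → Ω → Bg}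

/-- **THE KERNEL-MASS INEQUALITY OF `NE9EvaluationChannel.channelSizeAtStepNN_of_kernelMass` FROM THE LEVELS**: if the
weighted weight masses of the evaluation channel's source domains of creation step `j` are DOMINATED by a nested sum of
per-piece masses `m k s y □₀ Y₀ X` over index data `P` (displayed structural identity `hdom` — e.g. when the weight of a source
domain is the sum of the (1.23) contour weights of its pieces on a common parameter space, `∫|Σ w| ≤ Σ∫|w|`), the per-piece
masses obey the (1.24)×(1.25) shape WITHOUT the size factor (`hm`: K ↔ 8B₀C₁e^{16κ₁}α₂⁻¹ε₁(α₁/α₃)⁵ — the term's size E₀ is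
supplied by P2's theorem), and the level counts hold, then `Σ_{X: scale j} e^{−κd(X)}·∫|w_X| ≤ wt k y·τ k j` with
`wt = weightOf`, `τ = tauOf`. [cite: Balaban1988RG2Cluster, (1.24)-(1.28) pp.7-8] -/
theorem kernelMass_of_levels (P : PieceData C Bg ι α β γ) {κ κ₁ d0 O1 L : ℝ} {Kp : ℕ → ι → ℝ} {ℓ : ℕ → ℕ → ℝ}
    (m : ℕ → (ℕ → ℝ) → ι → α → β → C.Dom → ℝ)
    (hdom : ∀ (k j : ℕ) (s : ℕ → ℝ) (y : ι),
      ∑ X ∈ (F k s y).filter (fun X => C.scale X = j), Real.exp (-(κ * C.d X)) * ∫ ω, |w k s y X ω| ∂(ν k s y X)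
        ≤ ∑ a ∈ P.S0 k y, ∑ b ∈ P.SY k y a, ∑ x ∈ P.src k y a j, m k s y a b x)
    (hm : ∀ (k : ℕ) (s : ℕ → ℝ) (y : ι), ∀ a ∈ P.S0 k y, ∀ b ∈ P.SY k y a, ∀ (j : ℕ), ∀ x ∈ P.src k y a j,
      0 ≤ m k s y a b x ∧ m k s y a b x ≤ Kp k y * ℓ k j ^ 5 * Real.exp (-(κ * C.d x)) *
        Real.exp (-(1 / 8) * (κ₁ - 1) * P.dY k y + (1 / 8) * κ₁ * d0 - (1 / 2) * (κ₁ - 1) * P.vol k y a b))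
    (hL : LevelCounts P κ κ₁ O1 L ℓ) (hKp : ∀ k y, 0 ≤ Kp k y) (hO1 : 0 ≤ O1) (hℓ : ∀ k j, 0 ≤ ℓ k j)
    (k j : ℕ) (s : ℕ → ℝ) (y : ι) :
    ∑ X ∈ (F k s y).filter (fun X => C.scale X = j), Real.exp (-(κ * C.d X)) * ∫ ω, |w k s y X ω| ∂(ν k s y X)
      ≤ weightOf P κ₁ d0 O1 Kp k y * tauOf L ℓ k j := by
  have h := levels_bound P hL (hKp k y) hO1 hℓ k y j (fun a b x => m k s y a b x)
    (fun a ha b hb x hx => (hm k s y a ha b hb j x hx).1) (fun a ha b hb x hx => (hm k s y a ha b hb j x hx).2)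
  refine (hdom k j s y).trans (h.trans (le_of_eq ?_))
  simp only [weightOf, tauOf]; ring

/-- **P2's S5 LEAF WITH ITS MASS HYPOTHESIS DISCHARGED BY THE LEVELS**: `ChannelSizeAtStepNN (EvalAdm …) (evalChannel …) κ
(weightOf …) (tauOf …)` = `NE9EvaluationChannel.channelSizeAtStepNN_of_kernelMass` ∘ `kernelMass_of_levels`. [folklore] -/
theorem channelSizeAtStepNN_eval_of_levels (P : PieceData C Bg ι α β γ) {κ κ₁ d0 O1 L : ℝ} {Kp : ℕ → ι → ℝ}
    {ℓ : ℕ → ℕ → ℝ} (m : ℕ → (ℕ → ℝ) → ι → α → β → C.Dom → ℝ)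
    (hw : ∀ k s y, ∀ X ∈ F k s y, Integrable (w k s y X) (ν k s y X))
    (hdom : ∀ (k j : ℕ) (s : ℕ → ℝ) (y : ι),
      ∑ X ∈ (F k s y).filter (fun X => C.scale X = j), Real.exp (-(κ * C.d X)) * ∫ ω, |w k s y X ω| ∂(ν k s y X)
        ≤ ∑ a ∈ P.S0 k y, ∑ b ∈ P.SY k y a, ∑ x ∈ P.src k y a j, m k s y a b x)
    (hm : ∀ (k : ℕ) (s : ℕ → ℝ) (y : ι), ∀ a ∈ P.S0 k y, ∀ b ∈ P.SY k y a, ∀ (j : ℕ), ∀ x ∈ P.src k y a j,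
      0 ≤ m k s y a b x ∧ m k s y a b x ≤ Kp k y * ℓ k j ^ 5 * Real.exp (-(κ * C.d x)) *
        Real.exp (-(1 / 8) * (κ₁ - 1) * P.dY k y + (1 / 8) * κ₁ * d0 - (1 / 2) * (κ₁ - 1) * P.vol k y a b))
    (hL : LevelCounts P κ κ₁ O1 L ℓ) (hKp : ∀ k y, 0 ≤ Kp k y) (hO1 : 0 ≤ O1) (hℓ : ∀ k j, 0 ≤ ℓ k j) :
    ChannelSizeAtStepNN (EvalAdm F ν w bg) (evalChannel F ν w bg) κ (weightOf P κ₁ d0 O1 Kp) (tauOf L ℓ) :=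
  channelSizeAtStepNN_of_kernelMass hw fun k j s y => kernelMass_of_levels P m hdom hm hL hKp hO1 hℓ k j s y

end Eval

/-! ## §2 Non-vacuity: a one-piece toy inhabiting every hypothesis of §3 -/

section Toy

/-- Toy carriers: one domain per creation step (`Dom = ℕ`, `scale = id`, `d = 0`), trivial backgrounds. [folklore] -/
def toyC : Carriers where
  Dom := ℕ
  scale := fun j => j
  d := fun _ => 0
  d_nonneg := fun _ => le_rfl
  BgA := Unit
  BgB := Unit
  gauge := fun _ _ => 0
  gauge_nonneg := fun _ _ => le_rfl
  transport := fun _ => ()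

/-- The toy domain of creation step `j`. [folklore] -/
def toyDom (j : ℕ) : toyC.Dom := j

/-- `scale (toyDom j) = j`. [folklore] -/
@[simp] theorem toy_scale (j : ℕ) : toyC.scale (toyDom j) = j := rfl

/-- `d = 0` on the toy carriers. [folklore] -/
@[simp] theorem toy_d (x : toyC.Dom) : toyC.d x = 0 := rfl

/-- `c`-times evaluation of a function `Unit → ℝ` at the point, as an additive functional. [folklore] -/
def scaledEval (c : ℝ) : (Unit → ℝ) →+ ℝ where
  toFun f := c * f ()
  map_zero' := by simp
  map_add' f g := by simp only [Pi.add_apply]; ring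

/-- `scaledEval c f = c·f ()`. [folklore] -/
@[simp] theorem scaledEval_apply (c : ℝ) (f : Unit → ℝ) : scaledEval c f = c * f () := rfl

/-- The toy piece data: one box, one Y₀, one source per creation step (the domain `toyDom j`), one counting cube with the
one-element fibre, zero volume, zero output tree length, piece at a source `x` = `c k (scale x)`-times evaluation. [folklore] -/
def toyP (c : ℕ → ℕ → ℝ) : PieceData toyC Unit Unit Unit Unit Unit where
  S0 := fun _ _ => {()}
  SY := fun _ _ _ => {()}
  src := fun _ _ _ j => {toyDom j}
  Sq := fun _ _ _ _ => {()}
  SX := fun _ _ _ j _ => {toyDom j}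
  vol := fun _ _ _ _ => 0
  dY := fun _ _ => 0
  piece := fun k _ _ _ _ x => scaledEval (c k (toyC.scale x))

/-- The toy sources have the right creation step. [folklore] -/
theorem toy_srcScale (c : ℕ → ℕ → ℝ) : SrcScale (toyP c) := by
  intro k y a j x hx
  have hx' : x = toyDom j := Finset.mem_singleton.mp hx
  rw [hx', toy_scale]

/-- With `|c k j| ≤ Kp·ℓ k j⁵·exp(⅛κ₁d₀)` the toy pieces obey `PieceBound` (d = 0, vol = 0, dY = 0). [folklore] -/
theorem toy_pieceBound {κ κ₁ d0 Kp : ℝ} {ℓ : ℕ → ℕ → ℝ} {c : ℕ → ℕ → ℝ}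
    (hc : ∀ k j, |c k j| ≤ Kp * ℓ k j ^ 5 * Real.exp ((1 / 8) * κ₁ * d0)) :
    PieceBound (toyP c) κ κ₁ d0 (fun _ _ => Kp) ℓ := by
  intro k s y a _ b _ j x hx f N _ hf
  have hx' : x = toyDom j := Finset.mem_singleton.mp hx
  have hf0 := hf ()
  rw [toy_d, mul_zero, neg_zero, Real.exp_zero, one_mul] at hf0
  have hpiece : (toyP c).piece k s y a b x f = c k j * f () := by rw [hx']; rfl
  have hvol : (toyP c).vol k y a b = 0 := rfl
  have hdY : (toyP c).dY k y = 0 := rfl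
  rw [hpiece, hvol, hdY, toy_d, abs_mul, mul_zero, neg_zero, Real.exp_zero, mul_one]
  have hexp : Real.exp (-(1 / 8) * (κ₁ - 1) * (0:ℝ) + (1 / 8) * κ₁ * d0 - (1 / 2) * (κ₁ - 1) * 0)
      = Real.exp ((1 / 8) * κ₁ * d0) := by congr 1; ring
  rw [hexp]
  have hK0 : 0 ≤ Kp * ℓ k j ^ 5 * Real.exp ((1 / 8) * κ₁ * d0) := (abs_nonneg _).trans (hc k j)
  calc |c k j| * |f ()| ≤ (Kp * ℓ k j ^ 5 * Real.exp ((1 / 8) * κ₁ * d0)) * N :=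
        mul_le_mul (hc k j) hf0 (abs_nonneg _) hK0
    _ = Kp * N * ℓ k j ^ 5 * Real.exp ((1 / 8) * κ₁ * d0) := by ring

/-- The toy level counts with O1 = 1: the cover is trivial, the fibre weight is e⁰ = 1, the □′-count needs `ℓ⁵ ≤ (6L)⁴ℓ`
(true for 0 ≤ ℓ ≤ 1 ≤ 6L), (1.27) needs `1 ≤ e`, (1.28) needs `1 ≤ exp 0`. [folklore] -/
theorem toy_levelCounts {κ κ₁ L : ℝ} (hL : 1 ≤ 6 * L) {ℓ : ℕ → ℕ → ℝ} (hℓ0 : ∀ k j, 0 ≤ ℓ k j) (hℓ1 : ∀ k j, ℓ k j ≤ 1)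
    (c : ℕ → ℕ → ℝ) : LevelCounts (toyP c) κ κ₁ 1 L ℓ := by
  refine ⟨?_, ?_, ?_, ?_, ?_⟩
  · intro k y a j x hx
    exact ⟨(), Finset.mem_singleton_self _, hx⟩
  · intro k y a j q _
    show ∑ x ∈ ({toyDom j} : Finset toyC.Dom), Real.exp (-(κ * toyC.d x)) ≤ 1
    rw [Finset.sum_singleton, toy_d, mul_zero, neg_zero, Real.exp_zero]
  · intro k y a j
    show (({()} : Finset Unit).card : ℝ) * ℓ k j ^ 5 ≤ (6 * L) ^ 4 * ℓ k j
    rw [Finset.card_singleton, Nat.cast_one, one_mul]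
    have h6 : (1:ℝ) ≤ (6 * L) ^ 4 := one_le_pow₀ hL
    calc ℓ k j ^ 5 = ℓ k j ^ 4 * ℓ k j := by ring
      _ ≤ 1 * ℓ k j := mul_le_mul_of_nonneg_right (pow_le_one₀ (hℓ0 k j) (hℓ1 k j)) (hℓ0 k j)
      _ ≤ (6 * L) ^ 4 * ℓ k j := mul_le_mul_of_nonneg_right h6 (hℓ0 k j)
  · intro k y a _
    show ∑ b ∈ ({()} : Finset Unit), Real.exp (-(1 / 2) * (κ₁ - 1) * (0:ℝ)) ≤ Real.exp 1
    rw [Finset.sum_singleton, mul_zero, Real.exp_zero]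
    exact Real.one_le_exp (by norm_num)
  · intro k y
    show (({()} : Finset Unit).card : ℝ) ≤ Real.exp ((1 / 16) * (κ₁ - 2) * (0:ℝ))
    rw [Finset.card_singleton, Nat.cast_one, mul_zero, Real.exp_zero]

/-- **NON-VACUITY**: with the printed factor truncated to the steps it is used at (`ℓ k j = min (L^j(L^k)⁻¹) 1`, equal to
`ellPrinted L k j` for `j ≤ k`), constants `|c k j| ≤ Kp·ℓ⁵·exp(⅛κ₁d₀)`, the toy channel satisfies the S5 binder with the
counted weight and `τ k j = (6L)⁴·ℓ k j` — every hypothesis of `channelSizeAtStepNN_piece` inhabited at once. [folklore] -/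
theorem toy_channelSizeAtStepNN {κ κ₁ d0 Kp L : ℝ} (hKp : 0 ≤ Kp) (hL : 1 ≤ L) {c : ℕ → ℕ → ℝ}
    (hc : ∀ k j, |c k j| ≤ Kp * (min (ellPrinted L k j) 1) ^ 5 * Real.exp ((1 / 8) * κ₁ * d0)) :
    ChannelSizeAtStepNN (C := toyC) Set.univ (pieceChannel (toyP c)) κ
      (weightOf (toyP c) κ₁ d0 1 (fun _ _ => Kp)) (tauOf L fun k j => min (ellPrinted L k j) 1) :=
  channelSizeAtStepNN_piece (toy_srcScale c) (toy_pieceBound (κ := κ) hc)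
    (toy_levelCounts (κ := κ) (κ₁ := κ₁) (by linarith)
      (fun k j => le_min (ellPrinted_nonneg (by linarith) k j) zero_le_one) (fun k j => min_le_right _ _) c)
    (fun _ _ => hKp) zero_le_one (fun k j => le_min (ellPrinted_nonneg (by linarith) k j) zero_le_one) Set.univ

/-- On the steps the binder uses (`j ≤ k`) the truncated factor IS the printed one, so the toy's profile is the geometric
profile `(6L)⁴·(L⁻¹)^{k−j}` of §4. [folklore] -/
theorem toy_tau_eq {L : ℝ} (hL : 1 ≤ L) {k j : ℕ} (hjk : j ≤ k) :
    tauOf L (fun k j => min (ellPrinted L k j) 1) k j = (6 * L) ^ 4 * L⁻¹ ^ (k - j) := by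
  simp only [tauOf]
  rw [min_eq_left (ellPrinted_le_one hL hjk), ellPrinted_eq_pow (show L ≠ 0 by linarith) hjk]

end Toy

end Summit.QuantumFields.BalabanUV.T4Continuum.NE9Lemma1CountingEval
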